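import Literature.NumberTheory.EllipticCurves.UniversalSigmaSpecializationProofs
import Literature.NumberTheory.EllipticCurves.FormalGroupShortModelParityProofs
import Mathlib.RingTheory.PowerSeries.NoZeroDivisors
import HarnessLib

/-!
# Blakestad–Grant's Prop. 13: the functional equation of `g = ∫ζ̃ω` from the canonical
# `p`-isogeny data, and the resulting isogeny criterion for `mazur_tate_sigma_existsUnique`
# (proofs only)

Trunk T-NT-EC (Literature/NumberTheory/EllipticCurves). Blakestad–Grant (*On the universal
`p`-adic sigma and Weierstrass zeta functions*, J. Number Theory 249 (2023), arXiv:1903.02480,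
§2.2) prove the integrality of the universal Mazur–Tate sigma function `σ = t·exp(g)`,
`g = ∫ζ̃ω`, over `R̂` (their Thm. 1) in three moves: (i) the canonical `p`-isogeny
`ψ : 𝓔 → 𝓔' = 𝓔/𝒢` supplies a Frobenius lift `α` of `R̂` with `𝓔' = α_*𝓔` (Prop. 7, Def. 8),
the parameter `t' = t_{p/H} ∈ tR̂⟦t⟧`, `t' ≡ tᵖ (mod p)`, `ψ^*ω' = (p/H)ω` (Prop. 7(c)), and its
Weierstrass factorisation `t' = d·u`, `d = H⁻¹tᵖφ_ψ(x(t))`, `u ≡ 1 (mod p)` (Lemma 12);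
(ii) **Prop. 13**: (a) `ζ_{𝓔'}(t') = Hζ_𝓔(t) + (H/p)·Dφ_ψ(x)/φ_ψ(x)` and hence
(b) `g(t) - p⁻¹α(g)(t') = p⁻¹ log u(t) ∈ R̂⟦t⟧`; (iii) Hazewinkel's functional equation lemma
(Cor. 6(c)) then gives `exp(g) ∈ R̂⟦t⟧`.

The tree has (iii) over `R̂` (`UniversalOrdinaryFunctionalEquation.lean`:
`coeff_exp_subst_mem_intSubring'`) and the specialisation from `R̂` to the named fact
(`UniversalSigmaSpecializationProofs.lean`). This file proves (ii) — Prop. 13 — from the data of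
(i) taken as hypotheses, in a form that mentions NO points of `𝒢`: the only inputs beyond
`α`, `t' = d·u` and `ψ^*ω' = (p/H)ω` are

* the **parities** `t'(-t) = -t'(t)`, `d(-t) = -d(t)` (`ψ` commutes with `[-1]`; `x` is even), and
* the **geometric identity** behind Prop. 13(a) — Blakestad–Grant's Lemma 10 summed over
  `𝒢 ∖ O` ("`D(Dφ_ψ(x)/φ_ψ(x)) = px - T(x)`") combined with Vélu's `x₁ = T(x) - T'(x)` (Lemma 11)
  and the model change `x₁ = (p/H)²x_{p/H}` — in the pole-cleared power-series form

    `H²t'²·[t²(d·D²d - (Dd)²) - p·d²·η(tη_t - η)] = H²p·X·t'²d² - p²t²d²·X'(t') - c·t²t'²d²`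

  (`D = η·d/dt` the invariant derivation, `X = t²x(t)`, `X' = t'²x'(t')` for `𝓔' = α_*𝓔`,
  `c ∈ K` a constant: `c = H²·T'(x)`), which is literally "`D(Dd/d) - pD(η/t) =
  p·x - (p/H)²·x'(t') - T'(x)`" multiplied by `H²t²t'²d²` (note `Dφ_ψ/φ_ψ = Dd/d - p·Dt/t`).

Main results (`R̂ = completeRing p`, `K = R̂[1/p] = completeRingQ p`, `𝓔 = universalCurve p`,
`p ≥ 5`):

* `prop13_core`, `prop13a_identity` — the algebra of Prop. 13(a) over any commutative ring:
  with `δ = ζ̃'(t') - Hζ̃ + H·η·v'·u⁻¹` (`u = 1 + pv`, `ζ̃ = (Λ - η)/t`) one has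
  `t²t'²d²·(Hp·ηδ' - (p²β' + c - H²pβ)) = 0`;
* `eq_zero_of_formalEta_mul_derivative_map_eq_C` — a series `F ∈ R̂⟦t⟧` with `DF = const`
  has `DF = 0` (the Hasse coefficients `w_{pⁿ-1}` are units and `R̂` is `p`-adically separated:
  "`η = D(δ(t))` is in `R̂` … `η = 0`", eq. (9));
* `exists_log_one_add_integral` — `p⁻¹log(1 + pv) ∈ R̂⟦t⟧` for `v ∈ R̂⟦t⟧` ("`u(t) ≡ 1 mod p`,
  so `log(u(t))/p ∈ R̂⟦t⟧`");
* **`coeff_exp_sigmaExpArg_mem_intSubring_of_isogenyData`** — Prop. 13(a)+(b) + Cor. 6(c):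
  under the data above, `exp(sigmaExpArg 𝓔_K Λ_K) ∈ R̂⟦t⟧` for every even zeta series `Λ`;
* **`mazur_tate_sigma_existsUnique_of_isogenyData`** — hence the named fact
  `WeierstrassCurve.mazur_tate_sigma_existsUnique` (Mazur–Stein–Tate 2006, Thm. 1.3) follows
  from the existence, for every `p ≥ 5`, of such isogeny data over `R̂` (Blakestad–Grant's
  Prop. 7, Lemma 10 (summed), Lemma 11, Lemma 12 — the remaining algebro-geometric input).

## The argument (Blakestad–Grant, proof of Prop. 13 — reorganised without points)

Write `t'ζ̃' = Λ' - η'` (`Λ' = α(Λ)`, `η' = α(η)`), `T = t'(t)`, `λ = p/H`. From `ψ^*ω' = λω`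
(`H·η·T_t = p·η'(T)`) the chain rule reads `D(h(T)) = λ·(D'h)(T)`. Put
`δ = ζ̃'(T) - Hζ̃ + H·η v_t/u`. Using the zeta equations `Dζ = -x + β`, `D'ζ' = -x' + β'`,
`Dd/d = DT/T - Du/u`, `DT/T = λ·(η'/t')(T)` and the geometric identity, a direct computation
(`prop13_core`) gives `D δ = λβ' + c/(H²λ) - Hβ`, a CONSTANT. Every term of `δ` has
coefficients in `R̂` (`u = 1 + pv`), so by the units `w_{pⁿ-1}` and `p`-adic separatedness the
constant vanishes; `δ(0) = 0` by parity, so `δ = 0`, i.e. `ζ̃'(T) = Hζ̃ - Hηv_t/u` — this is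
Prop. 13(a). Then `d/dt[g - p⁻¹g'(T)] = ζ̃W - p⁻¹ζ̃'(T)W'(T)T_t = ζ̃W - H⁻¹ζ̃'(T)W = v_t/u`,
so `g - p⁻¹α(g)(T) = p⁻¹log(1 + pv) ∈ R̂⟦t⟧` — Prop. 13(b) — and Cor. 6(c) applies.

## Sources

* C. Blakestad, D. Grant, J. Number Theory 249 (2023) 348–376 (arXiv:1903.02480), §2.2:
  Prop. 7, Def. 8, Cor. 9, Lemma 10, Lemma 11, Lemma 12, Prop. 13 (a),(b) and proof, proof of
  Thm. 1. [BlakestadGrant2023]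
* B. Mazur, W. Stein, J. Tate, Doc. Math. Extra Vol. Coates (2006), Thm. 1.3. [MazurSteinTate2006]
* B. Mazur, J. Tate, *The `p`-adic sigma function*, Duke Math. J. 62 (1991), §3.

Pure proof file: no definitions, no named facts.
-/

noncomputable section

open PowerSeries Literature.NumberTheory.EllipticCurves

namespace Literature.NumberTheory.EllipticCurves.UniversalOrdinary

/-! ### The algebra of Prop. 13(a) -/

section Core

variable {K : Type*} [CommRing K]

/-- **The computation behind Prop. 13(a)**, as a polynomial identity: all "functions of `t'`"
enter through their values at `T = t'(t)` (`L0 = Λ'(T)`, `L1 = Λ'_{t'}(T)`, `e0 = η'(T)`,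
`e1 = η'_{t'}(T)`, `χ = X'(T)`, `zp0 = ζ̃'(T)`, `zp1 = ζ̃'_{t'}(T)`), and the conclusion says
`t²T²d²·(Hp·ηδ_t - (p²β' + c - H²pβ)) = 0` for `δ = zp0 - H z + H η v_t uᵢ`.
[Blakestad–Grant 2023, proof of Prop. 13(a) (eqs. (7)–(9))] [cite: BlakestadGrant2023, Prop. 13] -/
theorem prop13_core
    (Λ Λt η ηt 𝕏 L0 L1 e0 e1 χ T Tt Ttt d dt dtt u ut utt ui vt vtt z z1 zp0 zp1 t : K)
    (H p β β' c' : K)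
    (R1 : η * (t * Λt - Λ) = -(𝕏 - β * t ^ 2))
    (R2 : e0 * (T * L1 - L0) = -(χ - β' * T ^ 2))
    (R3 : H * η * Tt = p * e0)
    (R3d : H * (ηt * Tt + η * Ttt) = p * e1 * Tt)
    (R4 : H ^ 2 * T ^ 2 * (t ^ 2 * (d * η * (ηt * dt + η * dtt) - η ^ 2 * dt ^ 2)
        - p * d ^ 2 * η * (t * ηt - η)) =
        H ^ 2 * p * 𝕏 * T ^ 2 * d ^ 2 - p ^ 2 * t ^ 2 * d ^ 2 * χ - c' * t ^ 2 * T ^ 2 * d ^ 2)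
    (hT : T = d * u) (hTt : Tt = dt * u + d * ut) (hTtt : Ttt = dtt * u + 2 * dt * ut + d * utt)
    (hut : ut = p * vt) (hutt : utt = p * vtt) (hui : u * ui = 1)
    (R7 : t * z = Λ - η) (R7d : z + t * z1 = Λt - ηt)
    (R8 : T * zp0 = L0 - e0) (R8d : zp0 + T * zp1 = L1 - e1) :
    t ^ 2 * T ^ 2 * d ^ 2 *
      (H * p * (η * (zp1 * Tt - H * z1 + H * (ηt * vt * ui + η * vtt * ui - η * vt * ut * ui ^ 2)))
        - (p ^ 2 * β' + c' - H ^ 2 * p * β)) = 0 := by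
  -- (A) `H η T² ζ̃'(T)_t = -p(χ - β'T²) - p e0 (T e1 - e0)` (chain rule + both zeta equations)
  have hA : H * η * (T ^ 2 * (zp1 * Tt)) = -(p * (χ - β' * T ^ 2)) - p * e0 * (T * e1 - e0) := by
    have h1 : T ^ 2 * zp1 = T * (L1 - e1) - (L0 - e0) := by linear_combination T * R8d - R8
    linear_combination H * η * Tt * h1 + (T * L1 - L0 - (T * e1 - e0)) * R3 + p * R2
  -- (B) `t² η ζ̃_t = -(X - βt²) - η(tη_t - η)`
  have hB : η * (t ^ 2 * z1) = -(𝕏 - β * t ^ 2) - η * (t * ηt - η) := by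
    have h1 : t ^ 2 * z1 = t * (Λt - ηt) - (Λ - η) := by linear_combination t * R7d - R7
    linear_combination η * h1 + R1
  -- (C1) `p² e0 (T e1 - e0) = H² η M`, `M = T(η_t T_t + η T_tt) - η T_t²`
  have hC1 : p ^ 2 * (e0 * (T * e1 - e0)) =
      H ^ 2 * η * (T * (ηt * Tt + η * Ttt) - η * Tt ^ 2) := by
    linear_combination (-(p * T * e1) + p * e0 + H * η * Tt) * R3 - H * η * T * R3d
  -- (C2) `M = u² M_d + d² M_u`
  have hC2 : T * (ηt * Tt + η * Ttt) - η * Tt ^ 2 =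
      u ^ 2 * (d * (ηt * dt + η * dtt) - η * dt ^ 2) + d ^ 2 * (u * (ηt * ut + η * utt) - η * ut ^ 2) := by
    rw [hT, hTt, hTtt]; ring
  -- (C3) `p u² (η v_t uᵢ)_t = M_u`
  have hC3 : p * (u ^ 2 * (ηt * vt * ui + η * vtt * ui - η * vt * ut * ui ^ 2)) =
      u * (ηt * ut + η * utt) - η * ut ^ 2 := by
    rw [hut, hutt]
    linear_combination (p * u * (ηt * vt + η * vtt) - p ^ 2 * η * vt ^ 2 * (u * ui + 1)) * hui
  -- assembly: `d² ×` everything, and the geometric identity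
  rw [hT] at R4 hA hC1 hC2 ⊢
  linear_combination (p * t ^ 2 * d ^ 2) * hA - (H ^ 2 * p * d ^ 4 * u ^ 2) * hB
    + (H ^ 2 * η * t ^ 2 * d ^ 4) * hC3 - (t ^ 2 * d ^ 2) * hC1 - (t ^ 2 * d ^ 2 * H ^ 2 * η) * hC2 - R4

/-- Substituting into a constant. [folklore] -/
theorem subst_C_of_hasSubst {a : K⟦X⟧} (ha : HasSubst a) (r : K) : (C r : K⟦X⟧).subst a = C r := by
  rw [← coe_substAlgHom ha, show (C r : K⟦X⟧) = algebraMap K K⟦X⟧ r from rfl, AlgHom.commutes]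

/-- `u·uᵢ = 1 ⇒ uᵢ' = -u'·uᵢ²`. [folklore] -/
theorem derivative_inv_of_mul_eq_one {u ui : K⟦X⟧} (hui : u * ui = 1) :
    d⁄dX K ui = -(d⁄dX K u * ui ^ 2) := by
  have h := congrArg (d⁄dX K) hui
  rw [Derivation.leibniz, Derivation.map_one_eq_zero, smul_eq_mul, smul_eq_mul] at h
  linear_combination ui * h - (d⁄dX K ui) * hui

/-- **Prop. 13(a) as a power-series identity.** Let `Λ, η, X` and `Λ', η', X'` be the zeta
series / inverse differential / `t²x` of two curves, with `η(tΛ_t - Λ) = -(X - βt²)` and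
likewise primed; `T ∈ tK⟦t⟧` with `H·η·T_t = p·η'(T)` (`ψ^*ω' = (p/H)ω`); `T = d·u`,
`u = 1 + pv`, `u·uᵢ = 1`; `tζ = Λ - η`, `tζ' = Λ' - η'`; and the geometric identity (hypothesis
`R4`). Then `t²T²d²·(Hp·η·δ_t - (p²β' + c - H²pβ)) = 0` for
`δ = ζ'(T) - Hζ + H·η·v_t·uᵢ`. [Blakestad–Grant 2023, Prop. 13(a) and proof]
[cite: BlakestadGrant2023, Prop. 13] -/
theorem prop13a_identity (Λ η 𝕏 Λ' η' 𝕏' T d u ui v ζ ζ' : K⟦X⟧) (H p β β' c' : K)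
    (R1 : η * (X * d⁄dX K Λ - Λ) = -(𝕏 - C β * X ^ 2))
    (R2 : η' * (X * d⁄dX K Λ' - Λ') = -(𝕏' - C β' * X ^ 2))
    (hT0 : constantCoeff T = 0)
    (R3 : C H * η * d⁄dX K T = C p * η'.subst T)
    (R4 : C H ^ 2 * T ^ 2 * (X ^ 2 * (d * (η * d⁄dX K (η * d⁄dX K d)) - (η * d⁄dX K d) ^ 2)
        - C p * d ^ 2 * (η * (X * d⁄dX K η - η))) =
        C H ^ 2 * C p * 𝕏 * T ^ 2 * d ^ 2 - C p ^ 2 * X ^ 2 * d ^ 2 * 𝕏'.subst T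
          - C c' * X ^ 2 * T ^ 2 * d ^ 2)
    (hT : T = d * u) (hu : u = 1 + C p * v) (hui : u * ui = 1)
    (R7 : X * ζ = Λ - η) (R8 : X * ζ' = Λ' - η') :
    X ^ 2 * T ^ 2 * d ^ 2 * (C H * C p * (η * d⁄dX K (ζ'.subst T - C H * ζ + C H * η * d⁄dX K v * ui))
      - C (p ^ 2 * β' + c' - H ^ 2 * p * β)) = 0 := by
  have hTs : HasSubst T := HasSubst.of_constantCoeff_zero' hT0
  -- the substituted zeta equation of `E'`
  have R2T : η'.subst T * (T * (d⁄dX K Λ').subst T - Λ'.subst T) = -(𝕏'.subst T - C β' * T ^ 2) := by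
    have R2' : η' * (X * d⁄dX K Λ' - Λ') = C β' * X ^ 2 - 𝕏' := by linear_combination R2
    have h := congrArg (PowerSeries.subst T) R2'
    rw [subst_mul hTs, subst_sub hTs, subst_mul hTs, subst_X hTs, subst_sub hTs, subst_mul hTs,
      subst_C_of_hasSubst hTs, subst_pow hTs, subst_X hTs] at h
    linear_combination h
  -- derivative of `R3`
  have R3d : C H * (d⁄dX K η * d⁄dX K T + η * d⁄dX K (d⁄dX K T)) =
      C p * (d⁄dX K η').subst T * d⁄dX K T := by
    have h := congrArg (d⁄dX K) R3
    rw [Derivation.leibniz, Derivation.leibniz, derivative_C, Derivation.leibniz, derivative_C,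
      derivative_subst K hTs] at h
    simp only [smul_eq_mul] at h
    linear_combination h
  -- derivatives of `T = d u`, `u = 1 + p v`
  have hTt : d⁄dX K T = d⁄dX K d * u + d * d⁄dX K u := by
    rw [hT, Derivation.leibniz, smul_eq_mul, smul_eq_mul]; ring
  have hTtt : d⁄dX K (d⁄dX K T) = d⁄dX K (d⁄dX K d) * u + 2 * d⁄dX K d * d⁄dX K u
      + d * d⁄dX K (d⁄dX K u) := by
    rw [hTt, map_add, Derivation.leibniz, Derivation.leibniz]
    simp only [smul_eq_mul]; ring
  have hut : d⁄dX K u = C p * d⁄dX K v := by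
    rw [hu, map_add, Derivation.map_one_eq_zero, Derivation.leibniz, derivative_C, smul_zero,
      add_zero, smul_eq_mul, zero_add]
  have hutt : d⁄dX K (d⁄dX K u) = C p * d⁄dX K (d⁄dX K v) := by
    rw [hut, Derivation.leibniz, derivative_C, smul_zero, add_zero, smul_eq_mul]
  -- `tζ = Λ - η`, `t'ζ' = Λ' - η'` differentiated / substituted
  have R7d : ζ + X * d⁄dX K ζ = d⁄dX K Λ - d⁄dX K η := by
    have h := congrArg (d⁄dX K) R7
    rwa [Derivation.leibniz, derivative_X, map_sub, smul_eq_mul, smul_eq_mul, mul_one,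
      add_comm] at h
  have R8T : T * ζ'.subst T = Λ'.subst T - η'.subst T := by
    have h := congrArg (PowerSeries.subst T) R8
    rwa [subst_mul hTs, subst_X hTs, subst_sub hTs] at h
  have R8dT : ζ'.subst T + T * (d⁄dX K ζ').subst T = (d⁄dX K Λ').subst T - (d⁄dX K η').subst T := by
    have h := congrArg (d⁄dX K) R8
    rw [Derivation.leibniz, derivative_X, map_sub, smul_eq_mul, smul_eq_mul, mul_one,
      add_comm] at h
    have h' := congrArg (PowerSeries.subst T) h
    rwa [subst_add hTs, subst_mul hTs, subst_X hTs, subst_sub hTs] at h'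
  -- the derivative of `δ`
  have hδ : d⁄dX K (ζ'.subst T - C H * ζ + C H * η * d⁄dX K v * ui) =
      (d⁄dX K ζ').subst T * d⁄dX K T - C H * d⁄dX K ζ
        + C H * (d⁄dX K η * d⁄dX K v * ui + η * d⁄dX K (d⁄dX K v) * ui
          - η * d⁄dX K v * d⁄dX K u * ui ^ 2) := by
    rw [map_add, map_sub, derivative_subst K hTs]
    simp only [Derivation.leibniz, derivative_C, derivative_inv_of_mul_eq_one hui, smul_eq_mul]
    ring
  -- `R4` in the shape of `prop13_core`
  rw [Derivation.leibniz] at R4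
  simp only [smul_eq_mul] at R4
  have R4c : C H ^ 2 * T ^ 2 * (X ^ 2 * (d * η * (d⁄dX K η * d⁄dX K d + η * d⁄dX K (d⁄dX K d))
      - η ^ 2 * d⁄dX K d ^ 2) - C p * d ^ 2 * η * (X * d⁄dX K η - η)) =
      C H ^ 2 * C p * 𝕏 * T ^ 2 * d ^ 2 - C p ^ 2 * X ^ 2 * d ^ 2 * 𝕏'.subst T
        - C c' * X ^ 2 * T ^ 2 * d ^ 2 := by
    linear_combination R4
  rw [hδ]
  simp only [map_sub, map_add, map_mul, map_pow]
  have key := prop13_core Λ (d⁄dX K Λ) η (d⁄dX K η) 𝕏 (Λ'.subst T) ((d⁄dX K Λ').subst T)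
    (η'.subst T) ((d⁄dX K η').subst T) (𝕏'.subst T) T (d⁄dX K T) (d⁄dX K (d⁄dX K T)) d (d⁄dX K d)
    (d⁄dX K (d⁄dX K d)) u (d⁄dX K u) (d⁄dX K (d⁄dX K u)) ui (d⁄dX K v) (d⁄dX K (d⁄dX K v))
    ζ (d⁄dX K ζ) (ζ'.subst T) ((d⁄dX K ζ').subst T) X (C H) (C p) (C β) (C β') (C c')
    R1 R2T R3 R3d R4c hT hTt hTtt hut hutt hui R7 R7d R8T R8dT
  exact key

end Core

/-! ### Three lemmas over `R̂ ⊆ K` -/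

section Univ

variable (p : ℕ) [Fact p.Prime]

/-- A series `T ∈ R̂⟦t⟧` with `T ≡ tᵖ (mod p)` is nonzero in `K⟦t⟧` (`p ≥ 5`: `p ∉ R̂ˣ`).
[folklore] -/
theorem map_ne_zero_of_congr_X_pow (hp5 : 5 ≤ p) {T : PowerSeries (completeRing p)}
    (hT : ∀ n, coeff n T - (if n = p then 1 else 0) ∈ Ideal.span {(p : completeRing p)}) :
    PowerSeries.map (algebraMap (completeRing p) (completeRingQ p)) T ≠ 0 := by
  intro h
  have hc : coeff p T = 0 := by
    have h1 := congrArg (coeff p) h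
    rw [coeff_map, map_zero, ← map_zero (algebraMap (completeRing p) (completeRingQ p))] at h1
    exact algebraMap_completeRingQ_injective p hp5 h1
  have h1 := hT p
  rw [hc, if_pos rfl, zero_sub, Ideal.neg_mem_iff] at h1
  exact natCast_mem_nonunits p hp5
    (isUnit_of_dvd_one (Ideal.mem_span_singleton.mp h1))

/-- **"`η = D(δ)` is a constant in `R̂`, hence `0`"** (Blakestad–Grant, eq. (9)): if `F ∈ R̂⟦t⟧`
and `η_𝓔 · F_t = κ` is a constant of `K`, then `κ = 0`. Indeed `F_t = κ·ω/dt`, so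
`pⁿ⁺¹·[t^{pⁿ⁺¹}]F = κ·w_{pⁿ⁺¹-1}` with `w_{pⁿ⁺¹-1} ∈ R̂ˣ`, whence `κ ∈ ⋂ₙ pⁿ⁺¹R̂ = 0`
(`R̂` is `p`-adically separated). [Blakestad–Grant 2023, proof of Prop. 13(a), eq. (9)]
[cite: BlakestadGrant2023, Prop. 13] -/
theorem eq_zero_of_formalEta_mul_derivative_map_eq_C (hp5 : 5 ≤ p)
    (F : PowerSeries (completeRing p)) (κ : completeRingQ p)
    (h : ((universalCurve p).map (algebraMap (completeRing p) (completeRingQ p))).formalEta *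
      d⁄dX (completeRingQ p) (PowerSeries.map (algebraMap (completeRing p) (completeRingQ p)) F) =
      C κ) : κ = 0 := by
  have hp : p.Prime := Fact.out
  -- `F_t = κ · W` over `K`
  have hW : d⁄dX (completeRingQ p) (PowerSeries.map (algebraMap (completeRing p) (completeRingQ p)) F) =
      C κ * PowerSeries.map (algebraMap (completeRing p) (completeRingQ p)) (universalCurve p).formalInvDiff := by
    have hηW := ((universalCurve p).map (algebraMap (completeRing p) (completeRingQ p))).formalEta_mul_formalInvDiff
    rw [← (universalCurve p).map_formalInvDiff (algebraMap (completeRing p) (completeRingQ p))] at hηW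
    linear_combination (PowerSeries.map (algebraMap (completeRing p) (completeRingQ p))
      (universalCurve p).formalInvDiff) * h - (d⁄dX (completeRingQ p)
        (PowerSeries.map (algebraMap (completeRing p) (completeRingQ p)) F)) * hηW
  -- `κ = ι(p^{k+1} r_k)` for every `k`
  have hk : ∀ k : ℕ, ∃ r : completeRing p,
      κ = algebraMap (completeRing p) (completeRingQ p) ((p : completeRing p) ^ (k + 1) * r) := by
    intro k
    obtain ⟨w, hw⟩ := isUnit_coeff_formalInvDiff_universalCurve_pow p hp5 k
    have h1 := congrArg (coeff (p ^ (k + 1) - 1)) hW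
    rw [derivative_map, coeff_map, coeff_derivative, coeff_C_mul, coeff_map, ← hw] at h1
    have hn : p ^ (k + 1) - 1 + 1 = p ^ (k + 1) := Nat.sub_add_cancel (Nat.one_le_pow _ _ hp.pos)
    have hcast : ((p ^ (k + 1) - 1 : ℕ) : completeRing p) + 1 = (p : completeRing p) ^ (k + 1) := by
      have h := congrArg (Nat.cast (R := completeRing p)) hn
      push_cast at h
      exact h
    rw [hn, hcast] at h1
    refine ⟨coeff (p ^ (k + 1)) F * ↑w⁻¹, ?_⟩
    have h2 : κ = algebraMap (completeRing p) (completeRingQ p)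
        (coeff (p ^ (k + 1)) F * (p : completeRing p) ^ (k + 1)) *
          algebraMap (completeRing p) (completeRingQ p) ↑w⁻¹ := by
      rw [h1, mul_assoc, ← map_mul, Units.mul_inv, map_one, mul_one]
    rw [h2, ← map_mul]
    congr 1
    ring
  -- hence `κ = ι(s)` with `s ∈ ⋂ p^{k+1} R̂ = 0`
  obtain ⟨r₀, hr₀⟩ := hk 0
  have hs : ∀ k : ℕ, (p : completeRing p) ^ (0 + 1) * r₀ ∈
      Ideal.span {(p : completeRing p)} ^ (k + 1) := by
    intro k
    obtain ⟨r, hr⟩ := hk k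
    have heq : (p : completeRing p) ^ (0 + 1) * r₀ = (p : completeRing p) ^ (k + 1) * r :=
      algebraMap_completeRingQ_injective p hp5 (hr₀.symm.trans hr)
    rw [heq, Ideal.span_singleton_pow]
    exact Ideal.mul_mem_right _ _ (Ideal.mem_span_singleton_self _)
  have h0 : (p : completeRing p) ^ (0 + 1) * r₀ = 0 := by
    refine IsHausdorff.haus' (I := Ideal.span {(p : completeRing p)}) _ fun n => ?_
    rw [smodEq_smul_top_iff_sub_mem, sub_zero]
    rcases n with _ | k
    · rw [pow_zero, Ideal.one_eq_top]; exact Submodule.mem_top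
    · exact hs k
  rw [hr₀, h0, map_zero]

/-- A series over `K` with zero derivative is constant. [folklore] -/
theorem eq_C_of_derivative_eq_zero_completeRingQ {f : PowerSeries (completeRingQ p)}
    (h : d⁄dX (completeRingQ p) f = 0) : f = C (constantCoeff f) := by
  ext n
  rcases n with _ | n
  · simp
  · rw [coeff_C, if_neg (Nat.succ_ne_zero n)]
    have h1 := congrArg (coeff n) h
    rw [coeff_derivative, map_zero] at h1
    exact (isUnit_natCast_completeRingQ p (Nat.succ_ne_zero n)).mul_left_eq_zero.mp
      (by push_cast; linear_combination h1)

/-- **`p⁻¹·log(1 + pv) ∈ R̂⟦t⟧`** for `v ∈ tR̂⟦t⟧`: there is `L ∈ tR̂⟦t⟧` with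
`(1 + pv)·L_t = v_t` (namely `L = Σ_{k≥1} (-1)^{k+1} p^{k-1}vᵏ/k`, and `p^{k-1}/k ∈ ℤ_(p) ⊆ R̂`).
[Blakestad–Grant 2023, end of proof of Prop. 13 ("`u(t) ≡ 1 mod p`, so `log(u(t))/p ∈ R̂⟦t⟧`")]
[cite: BlakestadGrant2023, Prop. 13] -/
theorem exists_log_one_add_integral (v : PowerSeries (completeRing p)) (hv0 : constantCoeff v = 0) :
    ∃ L : PowerSeries (completeRing p), constantCoeff L = 0 ∧
      (1 + C (p : completeRingQ p) * PowerSeries.map (algebraMap (completeRing p) (completeRingQ p)) v) *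
        d⁄dX (completeRingQ p) (PowerSeries.map (algebraMap (completeRing p) (completeRingQ p)) L) =
        d⁄dX (completeRingQ p) (PowerSeries.map (algebraMap (completeRing p) (completeRingQ p)) v) := by
  set ι : completeRing p →+* completeRingQ p := algebraMap (completeRing p) (completeRingQ p) with hι
  have hp : p.Prime := Fact.out
  -- the coefficients `(-1)^{k+1} p^{k-1}/k` lie in `R̂`
  have hmem : ∀ k : ℕ, k ≠ 0 →
      algebraMap ℚ (completeRingQ p) ((-1) ^ (k + 1) * (p : ℚ) ^ (k - 1) / k) ∈ intSubring p := by
    intro k hk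
    obtain ⟨e, m, hm, hkm⟩ := Nat.exists_eq_pow_mul_and_not_dvd hk p hp.one_lt.ne'
    have hm0 : m ≠ 0 := by rintro rfl; exact hk (by rw [hkm, mul_zero])
    have he : e ≤ k - 1 := by
      have h1 : p ^ e ≤ k := by
        rw [hkm]; exact Nat.le_mul_of_pos_right _ (Nat.pos_of_ne_zero hm0)
      have h2 : e < p ^ e := Nat.lt_pow_self hp.one_lt
      omega
    have hq : ((-1) ^ (k + 1) * (p : ℚ) ^ (k - 1) / k : ℚ) =
        (-1) ^ (k + 1) * (p : ℚ) ^ (k - 1 - e) * (1 / m) := by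
      have hpe : (p : ℚ) ^ (k - 1) = (p : ℚ) ^ (k - 1 - e) * (p : ℚ) ^ e := by
        rw [← pow_add, Nat.sub_add_cancel he]
      have hp0 : (p : ℚ) ^ e ≠ 0 := pow_ne_zero _ (Nat.cast_ne_zero.mpr hp.ne_zero)
      have hm0' : (m : ℚ) ≠ 0 := Nat.cast_ne_zero.mpr hm0
      rw [hpe, hkm, Nat.cast_mul, Nat.cast_pow]
      field_simp
    rw [hq, map_mul, map_mul, map_pow, map_pow, map_neg, map_one, map_natCast]
    exact Subring.mul_mem _ (Subring.mul_mem _ (Subring.pow_mem _ (Subring.neg_mem _ (Subring.one_mem _)) _)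
      (Subring.pow_mem _ (natCast_mem _ p) _)) (algebraMap_one_div_mem_intSubring p hm)
  -- choose preimages `a k ∈ R̂`
  have hex : ∀ k : ℕ, ∃ r : completeRing p, k ≠ 0 →
      ι r = algebraMap ℚ (completeRingQ p) ((-1) ^ (k + 1) * (p : ℚ) ^ (k - 1) / k) := by
    intro k
    by_cases hk : k = 0
    · exact ⟨0, fun h => absurd hk h⟩
    · obtain ⟨r, hr⟩ := hmem k hk
      exact ⟨r, fun _ => hr⟩
  choose a ha using hex
  set A : PowerSeries (completeRing p) := PowerSeries.mk fun k => if k = 0 then 0 else a k with hA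
  have hAs0 : constantCoeff A = 0 := by
    rw [← coeff_zero_eq_constantCoeff_apply, hA, coeff_mk, if_pos rfl]
  have hvs : HasSubst v := HasSubst.of_constantCoeff_zero' hv0
  refine ⟨A.subst v, ?_, ?_⟩
  · rw [Literature.RingTheory.FormalGroups.constantCoeff_subst_of_constantCoeff_eq_zero hv0, hAs0]
  -- derivative of `A` over `K` is the geometric series `Σ (-p t)^k`
  have hv0' : constantCoeff (PowerSeries.map ι v) = 0 := by
    rw [← coeff_zero_eq_constantCoeff_apply, coeff_map, coeff_zero_eq_constantCoeff_apply, hv0, map_zero]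
  have hvs' : HasSubst (PowerSeries.map ι v) := HasSubst.of_constantCoeff_zero' hv0'
  have hdA : d⁄dX (completeRingQ p) (PowerSeries.map ι A) =
      PowerSeries.mk fun k => (-(p : completeRingQ p)) ^ k := by
    ext k
    rw [coeff_derivative, coeff_map, hA, coeff_mk, if_neg (Nat.succ_ne_zero k), coeff_mk,
      ha (k + 1) (Nat.succ_ne_zero k), Nat.add_sub_cancel,
      show ((k : completeRingQ p) + 1) = algebraMap ℚ (completeRingQ p) ((k + 1 : ℕ) : ℚ) by
        rw [map_natCast]; push_cast; rfl,
      ← map_mul]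
    have hq : ((-1) ^ (k + 1 + 1) * (p : ℚ) ^ k / ((k + 1 : ℕ) : ℚ) * ((k + 1 : ℕ) : ℚ) : ℚ) =
        (-(p : ℚ)) ^ k := by
      rw [div_mul_cancel₀ _ (by exact_mod_cast Nat.succ_ne_zero k), pow_succ, pow_succ, neg_pow]
      ring
    rw [hq, map_pow, map_neg, map_natCast]
  have hgeom : (1 + C (p : completeRingQ p) * X) *
      (PowerSeries.mk fun k => (-(p : completeRingQ p)) ^ k) = 1 := by
    ext n
    rcases n with _ | n
    · simp
    · rw [add_mul, one_mul, map_add, coeff_mk, mul_assoc, coeff_C_mul, coeff_succ_X_mul, coeff_mk,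
        coeff_one, if_neg (Nat.succ_ne_zero n), pow_succ]
      ring
  -- substitute `v`
  have hsub : (1 + C (p : completeRingQ p) * PowerSeries.map ι v) *
      (d⁄dX (completeRingQ p) (PowerSeries.map ι A)).subst (PowerSeries.map ι v) = 1 := by
    have h := congrArg (PowerSeries.subst (PowerSeries.map ι v)) hgeom
    rw [subst_mul hvs', subst_add hvs', subst_mul hvs', subst_X hvs', subst_C_of_hasSubst hvs',
      ← coe_substAlgHom hvs', map_one, coe_substAlgHom, ← hdA] at h
    exact h
  rw [Literature.RingTheory.FormalGroups.map_subst_apply hvs ι A, derivative_subst (completeRingQ p) hvs',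
    ← mul_assoc, hsub, one_mul]

end Univ

/-! ### Prop. 13: the functional equation, and the isogeny criterion -/

section Main

variable (p : ℕ) [Fact p.Prime]

set_option maxHeartbeats 1600000 in
/-- **Blakestad–Grant's Prop. 13 (a)+(b) with Cor. 6(c): the canonical-isogeny data force
`exp(∫ζ̃ω) ∈ R̂⟦t⟧`.** Let `p ≥ 5`, `𝓔 = universalCurve p` over `R̂ = completeRing p`,
`K = R̂[1/p]`, and suppose given:
a Frobenius lift `α` of `R̂` (`α(x) ≡ xᵖ`; Def. 8, so `𝓔' := α_*𝓔`); a unit `H ∈ R̂ˣ`;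
`T ∈ tR̂⟦t⟧` with `T ≡ tᵖ (mod p)` and `H·η_𝓔·T_t = p·η_{𝓔'}(T)` (i.e. `ψ^*ω' = (p/H)ω`,
Prop. 7(c)); a factorisation `T = d·u` with `u = 1 + pv`, `v ∈ tR̂⟦t⟧` (Lemma 12); the parities
`T(-t) = -T(t)`, `d(-t) = -d(t)`; and the geometric identity of Prop. 13(a) (Lemma 10 summed +
Lemma 11 + model change) in pole-cleared form over `K`,
`H²T²[t²(d·D²d - (Dd)²) - p d² η(tη_t - η)] = H²p X T² d² - p² t² d² X'(T) - c t² T² d²`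
(`D = η·d/dt`). Then for every even zeta series `Λ` of `𝓔` (`zΛ' - Λ = -(X - βz²)W`) the series
`exp(sigmaExpArg 𝓔_K Λ_K)` has all its coefficients in `R̂`.
[Blakestad–Grant 2023, Prop. 13 (a),(b), Cor. 6(c), proof of Thm. 1] [cite: BlakestadGrant2023, Prop. 13] -/
theorem coeff_exp_sigmaExpArg_mem_intSubring_of_isogenyData (hp5 : 5 ≤ p)
    (α : completeRing p →+* completeRing p)
    (hα : ∀ x, α x - x ^ p ∈ Ideal.span {(p : completeRing p)})
    {H : completeRing p} (hH : IsUnit H)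
    {T d u v : PowerSeries (completeRing p)} (hT0 : constantCoeff T = 0)
    (hTp : ∀ n, coeff n T - (if n = p then 1 else 0) ∈ Ideal.span {(p : completeRing p)})
    (hω : C H * (universalCurve p).formalEta * d⁄dX (completeRing p) T =
      C (p : completeRing p) * ((universalCurve p).map α).formalEta.subst T)
    (hTdu : T = d * u) (hu : u = 1 + C (p : completeRing p) * v) (hv0 : constantCoeff v = 0)
    (hTodd : rescale (-1 : completeRing p) T = -T) (hdodd : rescale (-1 : completeRing p) d = -d)
    (c' : completeRingQ p)
    (hG : C (algebraMap (completeRing p) (completeRingQ p) H) ^ 2 *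
        PowerSeries.map (algebraMap (completeRing p) (completeRingQ p)) T ^ 2 *
        (X ^ 2 * (PowerSeries.map (algebraMap (completeRing p) (completeRingQ p)) d *
            (((universalCurve p).map (algebraMap (completeRing p) (completeRingQ p))).formalEta *
              d⁄dX (completeRingQ p)
                (((universalCurve p).map (algebraMap (completeRing p) (completeRingQ p))).formalEta *
                  d⁄dX (completeRingQ p) (PowerSeries.map (algebraMap (completeRing p) (completeRingQ p)) d))) -
            (((universalCurve p).map (algebraMap (completeRing p) (completeRingQ p))).formalEta *
              d⁄dX (completeRingQ p) (PowerSeries.map (algebraMap (completeRing p) (completeRingQ p)) d)) ^ 2) -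
          C (p : completeRingQ p) * PowerSeries.map (algebraMap (completeRing p) (completeRingQ p)) d ^ 2 *
            (((universalCurve p).map (algebraMap (completeRing p) (completeRingQ p))).formalEta *
              (X * d⁄dX (completeRingQ p)
                ((universalCurve p).map (algebraMap (completeRing p) (completeRingQ p))).formalEta -
                ((universalCurve p).map (algebraMap (completeRing p) (completeRingQ p))).formalEta))) =
      C (algebraMap (completeRing p) (completeRingQ p) H) ^ 2 * C (p : completeRingQ p) *
          ((universalCurve p).map (algebraMap (completeRing p) (completeRingQ p))).formalXMulSq *
          PowerSeries.map (algebraMap (completeRing p) (completeRingQ p)) T ^ 2 *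
          PowerSeries.map (algebraMap (completeRing p) (completeRingQ p)) d ^ 2 -
        C (p : completeRingQ p) ^ 2 * X ^ 2 *
          PowerSeries.map (algebraMap (completeRing p) (completeRingQ p)) d ^ 2 *
          ((((universalCurve p).map α).map (algebraMap (completeRing p) (completeRingQ p))).formalXMulSq).subst
            (PowerSeries.map (algebraMap (completeRing p) (completeRingQ p)) T) -
        C c' * X ^ 2 * PowerSeries.map (algebraMap (completeRing p) (completeRingQ p)) T ^ 2 *
          PowerSeries.map (algebraMap (completeRing p) (completeRingQ p)) d ^ 2)
    {β : completeRing p} {Λ : PowerSeries (completeRing p)} (h0 : constantCoeff Λ = 1)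
    (hev : rescale (-1 : completeRing p) Λ = Λ)
    (hΛ : X * d⁄dX (completeRing p) Λ - Λ =
      -(((universalCurve p).formalXMulSq - C β * X ^ 2) * (universalCurve p).formalInvDiff)) (n : ℕ) :
    coeff n ((exp (completeRingQ p)).subst
      (((universalCurve p).map (algebraMap (completeRing p) (completeRingQ p))).sigmaExpArg
        (PowerSeries.map (algebraMap (completeRing p) (completeRingQ p)) Λ))) ∈ intSubring p := by
  have hp : p.Prime := Fact.out
  haveI := isDomain_completeRing p hp5
  haveI := isDomain_completeRingQ p hp5
  haveI : IsAddTorsionFree (completeRing p) := isAddTorsionFree_completeRing p hp5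
  -- the curves
  set ι : completeRing p →+* completeRingQ p := algebraMap (completeRing p) (completeRingQ p) with hι
  set E : WeierstrassCurve (completeRing p) := universalCurve p with hE
  set E' : WeierstrassCurve (completeRing p) := E.map α with hE'
  set EK : WeierstrassCurve (completeRingQ p) := E.map ι with hEK
  set E'K : WeierstrassCurve (completeRingQ p) := E'.map ι with hE'K
  have hinj : Function.Injective ι := algebraMap_completeRingQ_injective p hp5
  haveI hEsh : E.IsCharNeTwoNF := by rw [hE]; infer_instance
  haveI hE'sh : E'.IsCharNeTwoNF :=
    ⟨by rw [hE', WeierstrassCurve.map_a₁, hEsh.a₁, map_zero],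
     by rw [hE', WeierstrassCurve.map_a₃, hEsh.a₃, map_zero]⟩
  have hηW : EK.formalEta * EK.formalInvDiff = 1 := EK.formalEta_mul_formalInvDiff
  have hη'W : E'K.formalEta * E'K.formalInvDiff = 1 := E'K.formalEta_mul_formalInvDiff
  -- opaque names for the series over `K`
  obtain ⟨TK, hTK⟩ : ∃ S, PowerSeries.map ι T = S := ⟨_, rfl⟩
  obtain ⟨dK, hdK⟩ : ∃ S, PowerSeries.map ι d = S := ⟨_, rfl⟩
  obtain ⟨uK, huK⟩ : ∃ S, PowerSeries.map ι u = S := ⟨_, rfl⟩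
  obtain ⟨vK, hvK⟩ : ∃ S, PowerSeries.map ι v = S := ⟨_, rfl⟩
  obtain ⟨ΛK, hΛK⟩ : ∃ S, PowerSeries.map ι Λ = S := ⟨_, rfl⟩
  obtain ⟨Λ', hΛ'⟩ : ∃ S, PowerSeries.map α Λ = S := ⟨_, rfl⟩
  obtain ⟨Λ'K, hΛ'K⟩ : ∃ S, PowerSeries.map ι Λ' = S := ⟨_, rfl⟩
  rw [hTK, hdK] at hG
  have hTs : HasSubst T := HasSubst.of_constantCoeff_zero' hT0
  have hT0K : constantCoeff TK = 0 := by
    rw [← hTK, ← coeff_zero_eq_constantCoeff_apply, coeff_map, coeff_zero_eq_constantCoeff_apply, hT0,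
      map_zero]
  have hTKs : HasSubst TK := HasSubst.of_constantCoeff_zero' hT0K
  -- `T = d u`, `u = 1 + p v`, `u uᵢ = 1` over `K`
  have hTduK : TK = dK * uK := by rw [← hTK, hTdu, map_mul, hdK, huK]
  have huvK : uK = 1 + C (p : completeRingQ p) * vK := by
    rw [← huK, hu, map_add, map_one, map_mul, map_C, map_natCast, hvK]
  have hu0 : constantCoeff u = ((1 : (completeRing p)ˣ) : completeRing p) := by
    rw [Units.val_one, hu, map_add, map_one, map_mul, hv0, mul_zero, add_zero]
  obtain ⟨ui₀, hui₀⟩ : ∃ ui₀ : PowerSeries (completeRing p), u * ui₀ = 1 :=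
    ⟨PowerSeries.invOfUnit u 1, PowerSeries.mul_invOfUnit u 1 hu0⟩
  obtain ⟨ui, huidef⟩ : ∃ S, PowerSeries.map ι ui₀ = S := ⟨_, rfl⟩
  have hui : uK * ui = 1 := by rw [← huK, ← huidef, ← map_mul, hui₀, map_one]
  -- the zeta equations over `K`, in `η`-form
  have hΛK' := E.map_zetaSeries_eq ι hΛ
  rw [hΛK] at hΛK'
  have R1 : EK.formalEta * (X * d⁄dX (completeRingQ p) ΛK - ΛK) = -(EK.formalXMulSq - C (ι β) * X ^ 2) := by
    linear_combination EK.formalEta * hΛK' - (EK.formalXMulSq - C (ι β) * X ^ 2) * hηW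
  have hΛ'R := E.map_zetaSeries_eq α hΛ
  rw [hΛ'] at hΛ'R
  have hΛ'K' := E'.map_zetaSeries_eq ι hΛ'R
  rw [hΛ'K] at hΛ'K'
  have R2 : E'K.formalEta * (X * d⁄dX (completeRingQ p) Λ'K - Λ'K) =
      -(E'K.formalXMulSq - C (ι (α β)) * X ^ 2) := by
    linear_combination E'K.formalEta * hΛ'K' - (E'K.formalXMulSq - C (ι (α β)) * X ^ 2) * hη'W
  -- `ζ̃ = (Λ - η)/t`, `ζ̃' = (Λ' - η')/t'` over `R̂`, and their first coefficients
  have h1Λ : coeff 1 Λ = 0 := coeff_eq_zero_of_rescale_neg_one_eq_self hev odd_one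
  have h1η : coeff 1 E.formalEta = 0 :=
    coeff_eq_zero_of_rescale_neg_one_eq_self E.rescale_neg_one_formalEta odd_one
  have h1Λ' : coeff 1 Λ' = 0 := by rw [← hΛ', coeff_map, h1Λ, map_zero]
  have h1η' : coeff 1 E'.formalEta = 0 := by rw [hE', ← E.map_formalEta α, coeff_map, h1η, map_zero]
  have h0' : constantCoeff Λ' = 1 := by rw [← hΛ']; exact WeierstrassCurve.constantCoeff_map_eq_one α h0
  have h0K : constantCoeff ΛK = 1 := by rw [← hΛK]; exact WeierstrassCurve.constantCoeff_map_eq_one ι h0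
  have h0'K : constantCoeff Λ'K = 1 := by rw [← hΛ'K]; exact WeierstrassCurve.constantCoeff_map_eq_one ι h0'
  obtain ⟨ζ₀, hXζ₀, hζ₀0⟩ : ∃ ζ₀ : PowerSeries (completeRing p), X * ζ₀ = Λ - E.formalEta ∧
      constantCoeff ζ₀ = coeff 1 Λ - coeff 1 E.formalEta := by
    refine ⟨PowerSeries.mk fun n => coeff (n + 1) (Λ - E.formalEta), ?_, ?_⟩
    · have h := eq_X_mul_shift_add_const (Λ - E.formalEta)
      rw [map_sub, h0, E.constantCoeff_formalEta, sub_self, map_zero, add_zero] at h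
      exact h.symm
    · rw [← coeff_zero_eq_constantCoeff_apply, coeff_mk, zero_add, map_sub]
  obtain ⟨ζ'₀, hXζ'₀, hζ'₀0⟩ : ∃ ζ'₀ : PowerSeries (completeRing p), X * ζ'₀ = Λ' - E'.formalEta ∧
      constantCoeff ζ'₀ = coeff 1 Λ' - coeff 1 E'.formalEta := by
    refine ⟨PowerSeries.mk fun n => coeff (n + 1) (Λ' - E'.formalEta), ?_, ?_⟩
    · have h := eq_X_mul_shift_add_const (Λ' - E'.formalEta)
      rw [map_sub, h0', E'.constantCoeff_formalEta, sub_self, map_zero, add_zero] at h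
      exact h.symm
    · rw [← coeff_zero_eq_constantCoeff_apply, coeff_mk, zero_add, map_sub]
  obtain ⟨ζ, hζ⟩ : ∃ S, PowerSeries.map ι ζ₀ = S := ⟨_, rfl⟩
  obtain ⟨ζ', hζ'⟩ : ∃ S, PowerSeries.map ι ζ'₀ = S := ⟨_, rfl⟩
  have R7 : X * ζ = ΛK - EK.formalEta := by
    rw [← hζ, ← map_X ι, ← map_mul, hXζ₀, map_sub, E.map_formalEta ι, hΛK]
  have R8 : X * ζ' = Λ'K - E'K.formalEta := by
    rw [← hζ', ← map_X ι, ← map_mul, hXζ'₀, map_sub, E'.map_formalEta ι, hΛ'K]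
  -- `ψ^*ω' = (p/H)ω` over `K`
  have R3 : C (ι H) * EK.formalEta * d⁄dX (completeRingQ p) TK =
      C (p : completeRingQ p) * E'K.formalEta.subst TK := by
    have h := congrArg (PowerSeries.map ι) hω
    rw [map_mul, map_mul, map_C, E.map_formalEta ι, ← derivative_map, map_mul, map_C, map_natCast,
      Literature.RingTheory.FormalGroups.map_subst_apply hTs ι, E'.map_formalEta ι, hTK] at h
    exact h
  -- Prop. 13(a): `D δ` is a constant …
  have hid := prop13a_identity ΛK EK.formalEta EK.formalXMulSq Λ'K E'K.formalEta E'K.formalXMulSq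
    TK dK uK ui vK ζ ζ' (ι H) (p : completeRingQ p) (ι β) (ι (α β)) c' R1 R2 hT0K R3 hG hTduK huvK
    hui R7 R8
  obtain ⟨δ₀, hδ, hδ₀0⟩ : ∃ δ₀ : PowerSeries (completeRing p),
      PowerSeries.map ι δ₀ = ζ'.subst TK - C (ι H) * ζ +
        C (ι H) * EK.formalEta * d⁄dX (completeRingQ p) vK * ui ∧
      constantCoeff δ₀ = constantCoeff ζ'₀ - H * constantCoeff ζ₀ + H * coeff 1 v * constantCoeff ui₀ := by
    refine ⟨ζ'₀.subst T - C H * ζ₀ + C H * E.formalEta * d⁄dX (completeRing p) v * ui₀, ?_, ?_⟩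
    · rw [map_add, map_sub, map_mul, map_mul, map_mul, map_mul, map_C,
        Literature.RingTheory.FormalGroups.map_subst_apply hTs ι, E.map_formalEta ι, ← derivative_map,
        hζ', hTK, hζ, hvK, huidef]
    · rw [map_add, map_sub, map_mul, map_mul, map_mul, map_mul, constantCoeff_C,
        Literature.RingTheory.FormalGroups.constantCoeff_subst_of_constantCoeff_eq_zero hT0 ζ'₀,
        E.constantCoeff_formalEta, ← coeff_zero_eq_constantCoeff_apply (d⁄dX (completeRing p) v),
        coeff_derivative]
      ring
  rw [← hδ] at hid
  -- … cancel `t²T²d²`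
  have hX0 : (X : PowerSeries (completeRingQ p)) ≠ 0 := X_ne_zero
  have hTK0 : TK ≠ 0 := by rw [← hTK]; exact map_ne_zero_of_congr_X_pow p hp5 hTp
  have hdK0 : dK ≠ 0 := fun h => hTK0 (by rw [hTduK, h, zero_mul])
  have hid' : C (ι H) * C (p : completeRingQ p) *
      (EK.formalEta * d⁄dX (completeRingQ p) (PowerSeries.map ι δ₀)) -
      C ((p : completeRingQ p) ^ 2 * ι (α β) + c' - ι H ^ 2 * (p : completeRingQ p) * ι β) = 0 := by
    rcases mul_eq_zero.mp hid with h | h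
    · exact absurd h (mul_ne_zero (mul_ne_zero (pow_ne_zero 2 hX0) (pow_ne_zero 2 hTK0))
        (pow_ne_zero 2 hdK0))
    · exact h
  -- … which lies in `⋂ pⁿR̂ = 0`
  obtain ⟨Hi, hHi⟩ := (hH.map ι).exists_right_inv
  have hHi' : C (ι H) * C Hi = (1 : PowerSeries (completeRingQ p)) := by rw [← map_mul, hHi, map_one]
  obtain ⟨πi, hπi⟩ : ∃ S, algebraMap ℚ (completeRingQ p) (p : ℚ)⁻¹ = S := ⟨_, rfl⟩
  have hπ : (p : completeRingQ p) * πi = 1 := by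
    rw [← hπi, ← map_natCast (algebraMap ℚ (completeRingQ p)), ← map_mul, mul_inv_cancel₀
      (Nat.cast_ne_zero.mpr hp.ne_zero), map_one]
  have hπ' : C (p : completeRingQ p) * C πi = (1 : PowerSeries (completeRingQ p)) := by
    rw [← map_mul, hπ, map_one]
  have h3 : EK.formalEta * d⁄dX (completeRingQ p) (PowerSeries.map ι δ₀) =
      C (((p : completeRingQ p) ^ 2 * ι (α β) + c' - ι H ^ 2 * (p : completeRingQ p) * ι β) * Hi * πi) := by
    rw [map_mul, map_mul]
    linear_combination (C Hi * C πi) * hid'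
      - (EK.formalEta * d⁄dX (completeRingQ p) (PowerSeries.map ι δ₀) * (C (p : completeRingQ p) * C πi)) * hHi'
      - (EK.formalEta * d⁄dX (completeRingQ p) (PowerSeries.map ι δ₀)) * hπ'
  have hκ0 := eq_zero_of_formalEta_mul_derivative_map_eq_C p hp5 δ₀ _ h3
  rw [hκ0, map_zero] at h3
  have hD0 : d⁄dX (completeRingQ p) (PowerSeries.map ι δ₀) = 0 := by
    linear_combination EK.formalInvDiff * h3 - d⁄dX (completeRingQ p) (PowerSeries.map ι δ₀) * hηW
  -- `δ(0) = 0` by parity, hence `δ = 0`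
  have hd0 : d ≠ 0 := fun h => hdK0 (by rw [← hdK, h, map_zero])
  have hueven : rescale (-1 : completeRing p) u = u := by
    have h := congrArg (rescale (-1 : completeRing p)) hTdu
    rw [map_mul, hTodd, hdodd, hTdu, neg_mul, neg_inj] at h
    exact (mul_left_cancel₀ hd0 h).symm
  have hv1 : coeff 1 v = 0 := by
    have h := coeff_eq_zero_of_rescale_neg_one_eq_self hueven odd_one
    rw [hu, map_add, coeff_one, if_neg one_ne_zero, zero_add, coeff_C_mul] at h
    exact (natCast_pow_mul_eq_zero_iff_completeRing p hp5 1 (coeff 1 v)).mp (by rw [pow_one]; exact h)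
  have hδ00 : constantCoeff δ₀ = 0 := by
    rw [hδ₀0, hζ'₀0, hζ₀0, h1Λ, h1η, h1Λ', h1η', hv1]; ring
  have hδK0 : PowerSeries.map ι δ₀ = 0 := by
    rw [eq_C_of_derivative_eq_zero_completeRingQ p hD0, ← coeff_zero_eq_constantCoeff_apply, coeff_map,
      coeff_zero_eq_constantCoeff_apply, hδ00, map_zero, map_zero]
  -- Prop. 13(a): `ζ̃'(T) = Hζ̃ - H η v_t / u`
  have hstar : ζ'.subst TK = C (ι H) * ζ - C (ι H) * EK.formalEta * d⁄dX (completeRingQ p) vK * ui := by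
    rw [hδ] at hδK0
    linear_combination hδK0
  -- Prop. 13(b): the functional equation of `g = ∫ζ̃ω`
  obtain ⟨g, hg⟩ : ∃ S, EK.sigmaExpArg ΛK = S := ⟨_, rfl⟩
  obtain ⟨g', hg'⟩ : ∃ S, E'K.sigmaExpArg Λ'K = S := ⟨_, rfl⟩
  have hDg : d⁄dX (completeRingQ p) g = ζ * EK.formalInvDiff := by
    have h := WeierstrassCurve.X_mul_derivative_sigmaExpArg (W := EK) h0K
    rw [← EK.formalInvDiff_eq_formalOmega, hg] at h
    refine mul_left_cancel₀ hX0 ?_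
    rw [h]
    linear_combination (-EK.formalInvDiff) * R7 + hηW
  have hDg' : d⁄dX (completeRingQ p) g' = ζ' * E'K.formalInvDiff := by
    have h := WeierstrassCurve.X_mul_derivative_sigmaExpArg (W := E'K) h0'K
    rw [← E'K.formalInvDiff_eq_formalOmega, hg'] at h
    refine mul_left_cancel₀ hX0 ?_
    rw [h]
    linear_combination (-E'K.formalInvDiff) * R8 + hη'W
  have hηW'T : E'K.formalEta.subst TK * E'K.formalInvDiff.subst TK = 1 := by
    rw [← subst_mul hTKs, hη'W, ← coe_substAlgHom hTKs, map_one]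
  have hωW : C (ι H) * d⁄dX (completeRingQ p) TK * E'K.formalInvDiff.subst TK =
      C (p : completeRingQ p) * EK.formalInvDiff := by
    linear_combination (EK.formalInvDiff * E'K.formalInvDiff.subst TK) * R3
      - (C (ι H) * d⁄dX (completeRingQ p) TK * E'K.formalInvDiff.subst TK) * hηW
      + (C (p : completeRingQ p) * EK.formalInvDiff) * hηW'T
  have hDg'T : d⁄dX (completeRingQ p) (g'.subst TK) =
      C (p : completeRingQ p) * (ζ * EK.formalInvDiff - d⁄dX (completeRingQ p) vK * ui) := by
    rw [derivative_subst (completeRingQ p) hTKs, hDg', subst_mul hTKs]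
    linear_combination (E'K.formalInvDiff.subst TK * d⁄dX (completeRingQ p) TK) * hstar
      + (ζ - EK.formalEta * d⁄dX (completeRingQ p) vK * ui) * hωW
      - (C (p : completeRingQ p) * d⁄dX (completeRingQ p) vK * ui) * hηW
  obtain ⟨L, hL0, hL⟩ := exists_log_one_add_integral p v hv0
  rw [hvK, ← huvK] at hL
  obtain ⟨LK, hLK⟩ : ∃ S, PowerSeries.map ι L = S := ⟨_, rfl⟩
  rw [hLK] at hL
  have hDL : d⁄dX (completeRingQ p) LK = d⁄dX (completeRingQ p) vK * ui := by
    linear_combination ui * hL - d⁄dX (completeRingQ p) LK * hui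
  have hΦD : d⁄dX (completeRingQ p) (g - C πi * g'.subst TK - LK) = 0 := by
    rw [map_sub, map_sub, Derivation.leibniz, derivative_C, smul_zero, add_zero, smul_eq_mul, hDg,
      hDg'T, hDL]
    linear_combination (-(ζ * EK.formalInvDiff - d⁄dX (completeRingQ p) vK * ui)) * hπ'
  have hc0 : constantCoeff (g - C πi * g'.subst TK - LK) = 0 := by
    rw [map_sub, map_sub, map_mul, constantCoeff_C, ← hg, WeierstrassCurve.constantCoeff_sigmaExpArg,
      ← hg', Literature.RingTheory.FormalGroups.constantCoeff_subst_of_constantCoeff_eq_zero hT0K,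
      WeierstrassCurve.constantCoeff_sigmaExpArg, ← hLK, ← coeff_zero_eq_constantCoeff_apply,
      coeff_map, coeff_zero_eq_constantCoeff_apply, hL0, map_zero]
    ring
  have hΦ : g - C πi * g'.subst TK = LK := by
    have h := eq_C_of_derivative_eq_zero_completeRingQ p hΦD
    rw [hc0, map_zero] at h
    exact sub_eq_zero.mp h
  -- the data of Cor. 6(c)
  have hcurve : EK.map (extendQ p α) = E'K := by
    rw [hEK, hE'K, hE', WeierstrassCurve.map_map, WeierstrassCurve.map_map]
    congr 1
    exact RingHom.ext fun x => extendQ_algebraMap p α x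
  have hser : PowerSeries.map (extendQ p α) ΛK = Λ'K := by
    ext m
    rw [← hΛK, ← hΛ'K, ← hΛ', coeff_map, coeff_map, coeff_map, coeff_map, extendQ_algebraMap]
  have hmapg : PowerSeries.map (extendQ p α) g = g' := by
    rw [← hg, WeierstrassCurve.map_sigmaExpArg (extendQ p α) EK ΛK, hcurve, hser, hg']
  have hsm : ((p : ℚ)⁻¹ • g'.subst TK : PowerSeries (completeRingQ p)) = C πi * g'.subst TK := by
    ext m
    rw [coeff_smul, coeff_C_mul, Algebra.smul_def, hπi]
  have ha1 : coeff 1 g ∈ intSubring p := by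
    have h : coeff 1 g = constantCoeff (d⁄dX (completeRingQ p) g) := by
      rw [← coeff_zero_eq_constantCoeff_apply, coeff_derivative]; ring
    rw [h, hDg, ← hζ, hEK, ← E.map_formalInvDiff ι, ← map_mul, ← coeff_zero_eq_constantCoeff_apply,
      coeff_map]
    exact ⟨_, rfl⟩
  have hg0 : constantCoeff g = 0 := by rw [← hg]; exact WeierstrassCurve.constantCoeff_sigmaExpArg _
  have hfe : ∀ m, coeff m (g - (p : ℚ)⁻¹ • (PowerSeries.map (extendQ p α) g).subst
      (PowerSeries.map (algebraMap (completeRing p) (completeRingQ p)) T)) ∈ intSubring p := by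
    intro m
    rw [hmapg, ← hι, hTK, hsm, hΦ, ← hLK, coeff_map]
    exact ⟨_, rfl⟩
  have key := coeff_exp_subst_mem_intSubring' p α hα hT0 hTp hg0 ha1 hfe n
  rw [← hg, hEK, hι, ← hΛK] at key
  exact key

/-- **The isogeny criterion.** `WeierstrassCurve.mazur_tate_sigma_existsUnique`
(Mazur–Stein–Tate 2006, Thm. 1.3) holds as soon as, for every prime `p ≥ 5`, the universal
ordinary curve `𝓔/R̂` admits canonical-isogeny data in the sense of
`coeff_exp_sigmaExpArg_mem_intSubring_of_isogenyData`: a Frobenius lift `α` (Blakestad–Grant,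
Def. 8 with Prop. 7(a),(b)), a unit `H`, the parameter `T = t' ≡ tᵖ (mod p)` with
`ψ^*ω' = (p/H)ω` (Prop. 7(c)) factorised as `T = d·u`, `u ≡ 1 (mod p)` (Lemma 12), odd `T` and
`d`, and the pole-cleared identity of Lemma 10 (summed) + Lemma 11. (Then Prop. 13 and Cor. 6(c)
give Thm. 1 over `R̂`, and Thm. 15 specialises it: `UniversalSigmaSpecializationProofs`.)
[Blakestad–Grant 2023, Thm. 1 (proof), Prop. 7, Lemma 10–12, Prop. 13, Thm. 15;
Mazur–Stein–Tate 2006, Thm. 1.3] [cite: BlakestadGrant2023, Thm. 1] -/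
theorem _root_.WeierstrassCurve.mazur_tate_sigma_existsUnique_of_isogenyData
    (hdata : ∀ (p : ℕ) [Fact p.Prime], 5 ≤ p →
      ∃ (α : completeRing p →+* completeRing p) (H : completeRing p)
        (T d u v : PowerSeries (completeRing p)) (c' : completeRingQ p),
        (∀ x, α x - x ^ p ∈ Ideal.span {(p : completeRing p)}) ∧ IsUnit H ∧ constantCoeff T = 0 ∧
        (∀ n, coeff n T - (if n = p then 1 else 0) ∈ Ideal.span {(p : completeRing p)}) ∧
        C H * (universalCurve p).formalEta * d⁄dX (completeRing p) T =
          C (p : completeRing p) * ((universalCurve p).map α).formalEta.subst T ∧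
        T = d * u ∧ u = 1 + C (p : completeRing p) * v ∧ constantCoeff v = 0 ∧
        rescale (-1 : completeRing p) T = -T ∧ rescale (-1 : completeRing p) d = -d ∧
        (C (algebraMap (completeRing p) (completeRingQ p) H) ^ 2 *
            PowerSeries.map (algebraMap (completeRing p) (completeRingQ p)) T ^ 2 *
            (X ^ 2 * (PowerSeries.map (algebraMap (completeRing p) (completeRingQ p)) d *
                (((universalCurve p).map (algebraMap (completeRing p) (completeRingQ p))).formalEta *
                  d⁄dX (completeRingQ p)
                    (((universalCurve p).map (algebraMap (completeRing p) (completeRingQ p))).formalEta *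
                      d⁄dX (completeRingQ p) (PowerSeries.map (algebraMap (completeRing p) (completeRingQ p)) d))) -
                (((universalCurve p).map (algebraMap (completeRing p) (completeRingQ p))).formalEta *
                  d⁄dX (completeRingQ p) (PowerSeries.map (algebraMap (completeRing p) (completeRingQ p)) d)) ^ 2) -
              C (p : completeRingQ p) * PowerSeries.map (algebraMap (completeRing p) (completeRingQ p)) d ^ 2 *
                (((universalCurve p).map (algebraMap (completeRing p) (completeRingQ p))).formalEta *
                  (X * d⁄dX (completeRingQ p)
                    ((universalCurve p).map (algebraMap (completeRing p) (completeRingQ p))).formalEta -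
                    ((universalCurve p).map (algebraMap (completeRing p) (completeRingQ p))).formalEta))) =
          C (algebraMap (completeRing p) (completeRingQ p) H) ^ 2 * C (p : completeRingQ p) *
              ((universalCurve p).map (algebraMap (completeRing p) (completeRingQ p))).formalXMulSq *
              PowerSeries.map (algebraMap (completeRing p) (completeRingQ p)) T ^ 2 *
              PowerSeries.map (algebraMap (completeRing p) (completeRingQ p)) d ^ 2 -
            C (p : completeRingQ p) ^ 2 * X ^ 2 *
              PowerSeries.map (algebraMap (completeRing p) (completeRingQ p)) d ^ 2 *
              ((((universalCurve p).map α).map (algebraMap (completeRing p) (completeRingQ p))).formalXMulSq).subst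
                (PowerSeries.map (algebraMap (completeRing p) (completeRingQ p)) T) -
            C c' * X ^ 2 * PowerSeries.map (algebraMap (completeRing p) (completeRingQ p)) T ^ 2 *
              PowerSeries.map (algebraMap (completeRing p) (completeRingQ p)) d ^ 2)) :
    WeierstrassCurve.mazur_tate_sigma_existsUnique :=
  WeierstrassCurve.mazur_tate_sigma_existsUnique_of_universal_exp_sigmaExpArg_integral'
    fun p _ hp β Λ h0 hev hΛ n => by
      obtain ⟨α, H, T, d, u, v, c', hα, hH, hT0, hTp, hω, hTdu, hu, hv0, hTodd, hdodd, hG⟩ := hdata p hp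
      exact coeff_exp_sigmaExpArg_mem_intSubring_of_isogenyData p hp α hα hH hT0 hTp hω hTdu hu hv0
        hTodd hdodd c' hG h0 hev hΛ n

end Main

end Literature.NumberTheory.EllipticCurves.UniversalOrdinary
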